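import Mathlib
import Literature.MathematicalPhysics.StatisticalMechanics.Crystallization
import Literature.MathematicalPhysics.StatisticalMechanics.LennardJonesClusters
import Literature.MathematicalPhysics.StatisticalMechanics.OneCrossingMixture
import Summits.AtomisticToContinuum.Crystallization.Theses.ReggeStarCoercivity
import Summits.AtomisticToContinuum.Crystallization.Theorems.ReggeStarCoercivityStabilityConstantTwelveStubGaussSumMono

/-!
# Route `ReggeStarCoercivity`, crux stmt-AtomisticToContinuum-13601 `StabilityConstantTwelve`
# — line `Sketch`, stub `stub_hermite_pd` (Hermite dipole piece is positive definite in sum)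

For `t₀ > 0`, `c₁ ≤ 0` and `t₀ uₛ ≥ 3/2`, the radial function `h(u) = c₁ (u - uₛ) e^{-t₀ u}` of the
squared distance satisfies `Σ_{i,j} h(|x_i - x_j|²) ≥ 0` for every finite configuration in `ℝ³`.

Proof (no Fourier analysis beyond `stub_gaussSum_mono`): with the finite Gaussian pair sum
`S(t) = Σ_{i,j} e^{-t|x_i-x_j|²}` one has `S'(t) = -Σ_{i,j} |x_i-x_j|² e^{-t|x_i-x_j|²}`, and the
target sum equals `(-c₁) (S'(t₀) + uₛ S(t₀))`.  Since `F(t) = t^{3/2} S(t)` is non-decreasing on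
`(0, ∞)` (`stub_gaussSum_mono`) and differentiable at `t₀`, its derivative
`F'(t₀) = (3/2) t₀^{1/2} S(t₀) + t₀^{3/2} S'(t₀)` is `≥ 0`
(`HasDerivWithinAt.nonneg_of_monotoneOn`), i.e. `t₀ S'(t₀) ≥ -(3/2) S(t₀) ≥ -t₀ uₛ S(t₀)`.
-/

noncomputable section

namespace Summit.AtomisticToContinuum.Crystallization.Theorems

open MeasureTheory Set Real
open scoped Nat
open Literature.MathematicalPhysics.StatisticalMechanics

/-- Derivative of the finite Gaussian pair sum `S(t) = Σ_{i,j} e^{-t |x_i - x_j|²}`: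
`S'(t) = Σ_{i,j} e^{-t|x_i-x_j|²} · (-|x_i - x_j|²)`. -/
theorem hermitePd_hasDerivAt_gaussSum (N : ℕ) (x : Fin N → EuclideanSpace ℝ (Fin 3)) (t : ℝ) :
    HasDerivAt (fun s : ℝ => ∑ i, ∑ j, Real.exp (-(s * ‖x i - x j‖ ^ 2)))
      (∑ i, ∑ j, Real.exp (-(t * ‖x i - x j‖ ^ 2)) * -(‖x i - x j‖ ^ 2)) t :=
  HasDerivAt.fun_sum fun i _ => HasDerivAt.fun_sum fun j _ =>
    ((hasDerivAt_mul_const (‖x i - x j‖ ^ 2)).fun_neg).exp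

/-- The key derivative inequality: for the finite Gaussian pair sum
`S(t) = Σ_{i,j} e^{-t|x_i-x_j|²}` and `t₀ > 0`,
`t₀ Σ_{i,j} |x_i-x_j|² e^{-t₀|x_i-x_j|²} ≤ (3/2) S(t₀)`, i.e. `t₀ S'(t₀) ≥ -(3/2) S(t₀)`,
because `t ↦ t^{3/2} S(t)` is non-decreasing on `(0,∞)` (`stub_gaussSum_mono`). -/
theorem hermitePd_weighted_le (N : ℕ) (x : Fin N → EuclideanSpace ℝ (Fin 3)) {t₀ : ℝ}
    (ht₀ : 0 < t₀) :
    t₀ * ∑ i, ∑ j, ‖x i - x j‖ ^ 2 * Real.exp (-(t₀ * ‖x i - x j‖ ^ 2)) ≤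
      3 / 2 * ∑ i, ∑ j, Real.exp (-(t₀ * ‖x i - x j‖ ^ 2)) := by
  -- the monotone function `F(t) = t^{3/2} S(t)` and its derivative at `t₀`
  have hmono : MonotoneOn
      (fun t : ℝ => t ^ ((3 : ℝ) / 2) * ∑ i, ∑ j, Real.exp (-(t * ‖x i - x j‖ ^ 2))) (Ioi 0) :=
    fun t₁ ht₁ t₂ _ h => stub_gaussSum_mono N x ht₁ h
  have hF := (Real.hasDerivAt_rpow_const (p := (3 : ℝ) / 2) (Or.inl ht₀.ne')).fun_mul
    (hermitePd_hasDerivAt_gaussSum N x t₀)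
  have hacc : AccPt t₀ (Filter.principal (Ioi (0 : ℝ))) :=
    (uniqueDiffOn_Ioi (0 : ℝ) t₀ ht₀).accPt
  have hF' : 0 ≤ 3 / 2 * t₀ ^ ((3 : ℝ) / 2 - 1) * (∑ i, ∑ j, Real.exp (-(t₀ * ‖x i - x j‖ ^ 2))) +
      t₀ ^ ((3 : ℝ) / 2) * ∑ i, ∑ j, Real.exp (-(t₀ * ‖x i - x j‖ ^ 2)) * -(‖x i - x j‖ ^ 2) :=
    hF.hasDerivWithinAt.nonneg_of_monotoneOn hacc hmono
  -- rewrite `S'(t₀) = -B`, `t₀^{3/2} = t₀^{1/2} t₀`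
  have hSB : ∑ i, ∑ j, Real.exp (-(t₀ * ‖x i - x j‖ ^ 2)) * -(‖x i - x j‖ ^ 2) =
      -∑ i, ∑ j, ‖x i - x j‖ ^ 2 * Real.exp (-(t₀ * ‖x i - x j‖ ^ 2)) := by
    rw [← Finset.sum_neg_distrib]
    refine Finset.sum_congr rfl fun i _ => ?_
    rw [← Finset.sum_neg_distrib]
    refine Finset.sum_congr rfl fun j _ => ?_
    ring
  have hpow : t₀ ^ ((3 : ℝ) / 2) = t₀ ^ ((3 : ℝ) / 2 - 1) * t₀ := by
    rw [← Real.rpow_add_one ht₀.ne', sub_add_cancel]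
  have hQ : 0 < t₀ ^ ((3 : ℝ) / 2 - 1) := Real.rpow_pos_of_pos ht₀ _
  rw [hSB, hpow] at hF'
  -- divide by `t₀^{1/2} > 0`
  refine le_of_mul_le_mul_left ?_ hQ
  nlinarith [hF']

/-- STUB S5 (Hermite dipole piece is positive definite in sum). For `t₀ > 0`, `c₁ ≤ 0` and
`t₀ uₛ ≥ 3/2`, the radial function `h(u) = c₁ (u - uₛ) e^{-t₀ u}` of the squared distance satisfies
`Σ_{i,j} h(|x_i - x_j|²) ≥ 0` for every finite configuration in `ℝ³`: with
`S(t) = Σ_{i,j} e^{-t|x_i-x_j|²}` the sum is `(-c₁) (S'(t₀) + uₛ S(t₀))`, and since `t ↦ t^{3/2} S(t)`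
is non-decreasing (`stub_gaussSum_mono`), `S'(t₀) ≥ -(3/(2t₀)) S(t₀)`. -/
theorem stub_hermite_pd (t₀ uₛ c₁ : ℝ) (ht₀ : 0 < t₀) (hc₁ : c₁ ≤ 0) (hpd : 3 / 2 ≤ t₀ * uₛ)
    (N : ℕ) (x : Fin N → EuclideanSpace ℝ (Fin 3)) :
    0 ≤ ∑ i, ∑ j, c₁ * (‖x i - x j‖ ^ 2 - uₛ) * Real.exp (-(t₀ * ‖x i - x j‖ ^ 2)) := by
  set A := ∑ i, ∑ j, Real.exp (-(t₀ * ‖x i - x j‖ ^ 2)) with hA_def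
  set B := ∑ i, ∑ j, ‖x i - x j‖ ^ 2 * Real.exp (-(t₀ * ‖x i - x j‖ ^ 2)) with hB_def
  have hA : 0 ≤ A := Finset.sum_nonneg fun i _ => Finset.sum_nonneg fun j _ => (Real.exp_pos _).le
  have h1 : t₀ * B ≤ 3 / 2 * A := hermitePd_weighted_le N x ht₀
  have h2 : 3 / 2 * A ≤ t₀ * uₛ * A := mul_le_mul_of_nonneg_right hpd hA
  have h3 : B ≤ uₛ * A := le_of_mul_le_mul_left (by nlinarith [h1, h2]) ht₀
  have hsum : ∑ i, ∑ j, c₁ * (‖x i - x j‖ ^ 2 - uₛ) * Real.exp (-(t₀ * ‖x i - x j‖ ^ 2)) =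
      c₁ * B - c₁ * uₛ * A := by
    rw [hA_def, hB_def, Finset.mul_sum, Finset.mul_sum, ← Finset.sum_sub_distrib]
    refine Finset.sum_congr rfl fun i _ => ?_
    rw [Finset.mul_sum, Finset.mul_sum, ← Finset.sum_sub_distrib]
    refine Finset.sum_congr rfl fun j _ => ?_
    ring
  rw [hsum]
  have := mul_nonneg (neg_nonneg.mpr hc₁) (sub_nonneg.mpr h3)
  linarith

end Summit.AtomisticToContinuum.Crystallization.Theorems
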